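import Summits.BirchSwinnertonDyer.Rank1Residual.X9.PrintCertHeegnerCertsX9S4CD
import Summits.BirchSwinnertonDyer.Rank1Residual.X9.PrintCertTamagawaCertifiedX9S4R1
import Summits.BirchSwinnertonDyer.Rank1Residual.X9.PrintCertRecordsCertifiedX9S4R1
import HarnessLib

/-!
# The Heegner frame certificates PASS IN THE KERNEL — leaf X9, image `5S4`, slices `S4R1C`/`S4R1D` (J frames, `p` split): display theorems, screen census

HONEST FRAMING (cell `bsd-print-x9`, D-0131 (2) print tier): theorems only; no named fact; nothing asserted about any elliptic
curve beyond what the kernel rechecks; no pair is booked and no leaf is closed (`BSDpOnClassX9`, `BSDpOnClassX10b` stay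
`@[conjecture]`; cruxes J = item 20392 `HeegnerDivisibilityX9`, J₃ = item 21340 `HeegnerDivisibilityX10b` stay OPEN — their `∃ B, ∀ |d_K| > B`
shape is not refutable by finitely many frames). For each slice: `heegnerScreen_<Slice>` — every rank-`1` record has a Heegner
frame certificate (`X9/PrintCertHeegnerCerts*.lean`) passing `Record.heegnerCheck` (`X9/PrintCertHeegner.lean`), by `decide +kernel`;
hence (`X9/PrintCertHeegner.lean` soundness) for ANY imaginary quadratic `K` with `d_K = c.D` and ANY globally minimal `W / ℚ` with
`integralModelInt W = r.intCurve`: `frame_of_mem_<Slice>` — `K` satisfies the Heegner hypothesis for `N(W)` and for `p`, `|d_K| > 4`,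
`4N ∣ β² − d_K` — and `screen_of_mem_<Slice>` — `ord_p ∏_ℓ c_ℓ(W) ≤ v_p(m_K)` IN THE KERNEL'S CURRENCY
(through the slice's Tamagawa row certificates), `m_K` being the two-engine Heegner index of the frame (CLAIM, display file).
Kernel census `screenCensus_<Slice>`: how many frames have `v_p(m_K) = t` (then `Ш(E/K)[p] = 0` by Gross–Zagier–BSD, Jetchev Conj. 1.1)
and how many `v_p(m_K) > t` (`Ш(E^D)[p] ≠ 0`: `p^t ∣ y_K` with room to spare); none has `v_p(m_K) < t`.

References: [Jetchev2008] Conj. 1.1, Rem. 1.2, Thm. 1.4; [GrossZagier1986] V (2.1)–(2.3); [GrossLMS1991] §1; [Marcus1977] Ch. 3 Thm. 25.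
-/

set_option autoImplicit false

namespace Summit.BirchSwinnertonDyer.Rank1Residual.X9.PrintCert

open WeierstrassCurve Summit.BirchSwinnertonDyer.Rank1Residual.Additive
open Literature.NumberTheory.EllipticCurves (IsImaginaryQuadratic SatisfiesHeegnerHypothesis)

-- `decide +kernel` runs the frame arithmetic, trial divisions and `p`-adic valuations on every record: raise the recursion depth.
set_option maxRecDepth 100000

/-! ## Slice `S4R1C` (82 records, 82 of analytic rank `1`, 82 certificates) -/

/-- Every rank-`1` record of slice `S4R1C` has a Heegner frame certificate passing `Record.heegnerCheck`, IN THE KERNEL. [cite: Jetchev2008, Conj. 1.1] -/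
theorem heegnerScreen_S4R1C : heegnerScreen recordsS4R1C (fun r => r.rank == 1) heegnerCertsS4R1C = true := by
  decide +kernel

/-- Unpacked: a rank-`1` record of slice `S4R1C` has a passing Heegner frame certificate in `heegnerCertsS4R1C`. [cite: Jetchev2008, Conj. 1.1] -/
theorem exists_heegnerCheck_of_mem_S4R1C {r : Record} (hr : r ∈ recordsS4R1C) (h1 : r.rank = 1) :
    ∃ c ∈ heegnerCertsS4R1C, r.heegnerCheck c = true :=
  exists_heegnerCheck_of_heegnerScreen heegnerScreen_S4R1C hr (by simp [h1])

/-- **THE FRAME, slice `S4R1C`**: for a rank-`1` record, ANY imaginary quadratic `K` whose discriminant is the certificate's `D`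
satisfies the frame binders of crux J (item 20392): Heegner hypothesis for `N(W)` and for `p`, `|d_K| > 4`,
`4N ∣ β² − d_K` (record conductor), for ANY globally minimal `W` with the record's integral model. [cite: GrossLMS1991, §1 (p. 235)] [cite: Marcus1977, Ch. 3 Thm. 25] -/
theorem frame_of_mem_S4R1C {r : Record} (hr : r ∈ recordsS4R1C) (h1 : r.rank = 1) {W : WeierstrassCurve ℚ} [W.IsElliptic]
    [W.IsGloballyMinimal] (hI : integralModelInt W = r.intCurve) {K : Type} [Field K] [NumberField K]
    (hK : IsImaginaryQuadratic K) {q : ℕ} (hq : q = r.p) :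
    ∃ c ∈ heegnerCertsS4R1C, r.heegnerCheck c = true ∧ (NumberField.discr K = c.D →
      SatisfiesHeegnerHypothesis (W.conductorNorm ℤ) K ∧ SatisfiesHeegnerHypothesis q K ∧ 4 < (NumberField.discr K).natAbs ∧
      (4 * (r.conductor : ℤ)) ∣ (c.beta : ℤ) ^ 2 - NumberField.discr K ∧ (q = 3 → NumberField.discr K % 8 = 1)) := by
  obtain ⟨c, hc, hh⟩ := exists_heegnerCheck_of_mem_S4R1C hr h1
  exact ⟨c, hc, hh, fun hd => Record.frame_of_heegnerCheck hI (certified_S4R1C.check_of_mem hr) hh hK hd hq⟩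

/-- **THE SCREEN, slice `S4R1C`**: for a rank-`1` record and ANY globally minimal `W` with the record's integral model, the kernel
Tamagawa depth satisfies `ord_p ∏_ℓ c_ℓ(W) ≤ v_p(m_K)` for the frame's two-engine Heegner index `m_K = c.index` — the `n = 1`, `s = t`
instance of crux J on that frame, granted the display file's claim that `m_K` is the index. [cite: Jetchev2008, Conj. 1.1, Thm. 1.4] -/
theorem screen_of_mem_S4R1C {r : Record} (hr : r ∈ recordsS4R1C) (h1 : r.rank = 1) {W : WeierstrassCurve ℚ} [W.IsElliptic]
    [W.IsGloballyMinimal] (hI : integralModelInt W = r.intCurve) {q : ℕ} (hq : q = r.p) :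
    ∃ c ∈ heegnerCertsS4R1C, r.heegnerCheck c = true ∧ padicValNat q W.tamagawaProduct ≤ c.indexVal ∧
      2 * c.indexVal = 2 * padicValNat q W.tamagawaProduct + padicValNat q (r.shaAn * c.twistSha) := by
  obtain ⟨c, hc, hh⟩ := exists_heegnerCheck_of_mem_S4R1C hr h1
  obtain ⟨tc, -, htc⟩ := exists_tamCheck_of_mem_S4R1C hr
  exact ⟨c, hc, hh, Record.padicValNat_tamagawaProduct_le_indexVal_of_heegnerCheck hI hh htc hq,
    Record.two_mul_indexVal_eq_of_heegnerCheck hI hh htc hq⟩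

/-- KERNEL CENSUS, slice `S4R1C`: 82 certificates; `v_p(m_K) = t` on 77 frames (`Ш(E/K)[p] = 0` predicted), `v_p(m_K) > t` on 5
(`Ш(E^D)[p] ≠ 0`), `v_p(m_K) < t` on 0. [cite: Jetchev2008, Conj. 1.1] -/
theorem screenCensus_S4R1C : heegnerCertsS4R1C.length = 82 ∧
    (heegnerCertsS4R1C.filter fun c => c.indexVal == c.depth).length = 77 ∧
    (heegnerCertsS4R1C.filter fun c => decide (c.depth < c.indexVal)).length = 5 ∧
    (heegnerCertsS4R1C.filter fun c => decide (c.indexVal < c.depth)).length = 0 := by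
  decide +kernel

/-! ### Further frames of the J-live records of slice `S4R1C` (22 certificates) -/

/-- Every FURTHER frame certificate of slice `S4R1C` passes `Record.heegnerCheck` against a rank-`1` record of the slice, IN THE KERNEL
(so each is a route-compatible frame with the `n = 1` screen, by the soundness theorems of `X9/PrintCertHeegner.lean`). [cite: Jetchev2008, Conj. 1.1] -/
theorem extraPass_S4R1C : (heegnerCertsS4R1CExtra.all fun c => recordsS4R1C.any fun r => (r.rank == 1) && r.heegnerCheck c) = true := by
  decide +kernel

/-- Unpacked: each further frame certificate belongs to a rank-`1` record of slice `S4R1C` that it passes against. [cite: Jetchev2008, Conj. 1.1] -/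
theorem exists_record_of_mem_S4R1CExtra {c : HeegnerCert} (hc : c ∈ heegnerCertsS4R1CExtra) :
    ∃ r ∈ recordsS4R1C, r.rank = 1 ∧ r.heegnerCheck c = true := by
  have h := List.all_eq_true.1 extraPass_S4R1C c hc
  simp only [List.any_eq_true, Bool.and_eq_true, beq_iff_eq] at h
  obtain ⟨r, hr, h1, hh⟩ := h
  exact ⟨r, hr, h1, hh⟩

/-- KERNEL CENSUS of the further frames of slice `S4R1C`: 22 certificates; `v_p(m_K) = t` on 20, `> t` on 2 (listed with `D`),
`< t` on 0. [cite: Jetchev2008, Conj. 1.1] -/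
theorem extraCensus_S4R1C : heegnerCertsS4R1CExtra.length = 22 ∧
    (heegnerCertsS4R1CExtra.filter fun c => c.indexVal == c.depth).length = 20 ∧
    ((heegnerCertsS4R1CExtra.filter fun c => decide (c.depth < c.indexVal)).map fun c => (c.label, c.D)) = [("155682d1", -719), ("184512e1", -551)] ∧
    (heegnerCertsS4R1CExtra.filter fun c => decide (c.indexVal < c.depth)).length = 0 := by
  refine ⟨?_, ?_, ?_, ?_⟩ <;> decide +kernel

/-! ## Slice `S4R1D` (81 records, 81 of analytic rank `1`, 81 certificates) -/

/-- Every rank-`1` record of slice `S4R1D` has a Heegner frame certificate passing `Record.heegnerCheck`, IN THE KERNEL. [cite: Jetchev2008, Conj. 1.1] -/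
theorem heegnerScreen_S4R1D : heegnerScreen recordsS4R1D (fun r => r.rank == 1) heegnerCertsS4R1D = true := by
  decide +kernel

/-- Unpacked: a rank-`1` record of slice `S4R1D` has a passing Heegner frame certificate in `heegnerCertsS4R1D`. [cite: Jetchev2008, Conj. 1.1] -/
theorem exists_heegnerCheck_of_mem_S4R1D {r : Record} (hr : r ∈ recordsS4R1D) (h1 : r.rank = 1) :
    ∃ c ∈ heegnerCertsS4R1D, r.heegnerCheck c = true :=
  exists_heegnerCheck_of_heegnerScreen heegnerScreen_S4R1D hr (by simp [h1])

/-- **THE FRAME, slice `S4R1D`**: for a rank-`1` record, ANY imaginary quadratic `K` whose discriminant is the certificate's `D`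
satisfies the frame binders of crux J (item 20392): Heegner hypothesis for `N(W)` and for `p`, `|d_K| > 4`,
`4N ∣ β² − d_K` (record conductor), for ANY globally minimal `W` with the record's integral model. [cite: GrossLMS1991, §1 (p. 235)] [cite: Marcus1977, Ch. 3 Thm. 25] -/
theorem frame_of_mem_S4R1D {r : Record} (hr : r ∈ recordsS4R1D) (h1 : r.rank = 1) {W : WeierstrassCurve ℚ} [W.IsElliptic]
    [W.IsGloballyMinimal] (hI : integralModelInt W = r.intCurve) {K : Type} [Field K] [NumberField K]
    (hK : IsImaginaryQuadratic K) {q : ℕ} (hq : q = r.p) :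
    ∃ c ∈ heegnerCertsS4R1D, r.heegnerCheck c = true ∧ (NumberField.discr K = c.D →
      SatisfiesHeegnerHypothesis (W.conductorNorm ℤ) K ∧ SatisfiesHeegnerHypothesis q K ∧ 4 < (NumberField.discr K).natAbs ∧
      (4 * (r.conductor : ℤ)) ∣ (c.beta : ℤ) ^ 2 - NumberField.discr K ∧ (q = 3 → NumberField.discr K % 8 = 1)) := by
  obtain ⟨c, hc, hh⟩ := exists_heegnerCheck_of_mem_S4R1D hr h1
  exact ⟨c, hc, hh, fun hd => Record.frame_of_heegnerCheck hI (certified_S4R1D.check_of_mem hr) hh hK hd hq⟩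

/-- **THE SCREEN, slice `S4R1D`**: for a rank-`1` record and ANY globally minimal `W` with the record's integral model, the kernel
Tamagawa depth satisfies `ord_p ∏_ℓ c_ℓ(W) ≤ v_p(m_K)` for the frame's two-engine Heegner index `m_K = c.index` — the `n = 1`, `s = t`
instance of crux J on that frame, granted the display file's claim that `m_K` is the index. [cite: Jetchev2008, Conj. 1.1, Thm. 1.4] -/
theorem screen_of_mem_S4R1D {r : Record} (hr : r ∈ recordsS4R1D) (h1 : r.rank = 1) {W : WeierstrassCurve ℚ} [W.IsElliptic]
    [W.IsGloballyMinimal] (hI : integralModelInt W = r.intCurve) {q : ℕ} (hq : q = r.p) :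
    ∃ c ∈ heegnerCertsS4R1D, r.heegnerCheck c = true ∧ padicValNat q W.tamagawaProduct ≤ c.indexVal ∧
      2 * c.indexVal = 2 * padicValNat q W.tamagawaProduct + padicValNat q (r.shaAn * c.twistSha) := by
  obtain ⟨c, hc, hh⟩ := exists_heegnerCheck_of_mem_S4R1D hr h1
  obtain ⟨tc, -, htc⟩ := exists_tamCheck_of_mem_S4R1D hr
  exact ⟨c, hc, hh, Record.padicValNat_tamagawaProduct_le_indexVal_of_heegnerCheck hI hh htc hq,
    Record.two_mul_indexVal_eq_of_heegnerCheck hI hh htc hq⟩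

/-- KERNEL CENSUS, slice `S4R1D`: 81 certificates; `v_p(m_K) = t` on 75 frames (`Ш(E/K)[p] = 0` predicted), `v_p(m_K) > t` on 6
(`Ш(E^D)[p] ≠ 0`), `v_p(m_K) < t` on 0. [cite: Jetchev2008, Conj. 1.1] -/
theorem screenCensus_S4R1D : heegnerCertsS4R1D.length = 81 ∧
    (heegnerCertsS4R1D.filter fun c => c.indexVal == c.depth).length = 75 ∧
    (heegnerCertsS4R1D.filter fun c => decide (c.depth < c.indexVal)).length = 6 ∧
    (heegnerCertsS4R1D.filter fun c => decide (c.indexVal < c.depth)).length = 0 := by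
  decide +kernel

/-! ### Further frames of the J-live records of slice `S4R1D` (28 certificates) -/

/-- Every FURTHER frame certificate of slice `S4R1D` passes `Record.heegnerCheck` against a rank-`1` record of the slice, IN THE KERNEL
(so each is a route-compatible frame with the `n = 1` screen, by the soundness theorems of `X9/PrintCertHeegner.lean`). [cite: Jetchev2008, Conj. 1.1] -/
theorem extraPass_S4R1D : (heegnerCertsS4R1DExtra.all fun c => recordsS4R1D.any fun r => (r.rank == 1) && r.heegnerCheck c) = true := by
  decide +kernel

/-- Unpacked: each further frame certificate belongs to a rank-`1` record of slice `S4R1D` that it passes against. [cite: Jetchev2008, Conj. 1.1] -/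
theorem exists_record_of_mem_S4R1DExtra {c : HeegnerCert} (hc : c ∈ heegnerCertsS4R1DExtra) :
    ∃ r ∈ recordsS4R1D, r.rank = 1 ∧ r.heegnerCheck c = true := by
  have h := List.all_eq_true.1 extraPass_S4R1D c hc
  simp only [List.any_eq_true, Bool.and_eq_true, beq_iff_eq] at h
  obtain ⟨r, hr, h1, hh⟩ := h
  exact ⟨r, hr, h1, hh⟩

/-- KERNEL CENSUS of the further frames of slice `S4R1D`: 28 certificates; `v_p(m_K) = t` on 26, `> t` on 2 (listed with `D`),
`< t` on 0. [cite: Jetchev2008, Conj. 1.1] -/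
theorem extraCensus_S4R1D : heegnerCertsS4R1DExtra.length = 28 ∧
    (heegnerCertsS4R1DExtra.filter fun c => c.indexVal == c.depth).length = 26 ∧
    ((heegnerCertsS4R1DExtra.filter fun c => decide (c.depth < c.indexVal)).map fun c => (c.label, c.D)) = [("291312d1", -1679), ("424536dw1", -1319)] ∧
    (heegnerCertsS4R1DExtra.filter fun c => decide (c.indexVal < c.depth)).length = 0 := by
  refine ⟨?_, ?_, ?_, ?_⟩ <;> decide +kernel

end Summit.BirchSwinnertonDyer.Rank1Residual.X9.PrintCert
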